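import Mathlib
import HarnessLib
import Summits.Ventures.LatticeQCDFlow.Exactness.NCMCGeneralSpaceBennettRootConsistency
import Summits.Ventures.LatticeQCDFlow.Exactness.NCMCGeneralSpaceBennettRootLinearization
import Summits.Ventures.LatticeQCDFlow.Exactness.NCMCGeneralSpaceBennettRootVariance
import Summits.Ventures.LatticeQCDFlow.Exactness.NCMCGeneralSpaceTwoSampleCLT

/-!
# Asymptotic normality of the self-consistent Bennett (BAR) estimate: it attains Bennett's bound `1/G − 2`

HONEST FRAMING: exact (Metropolis-corrected) sampling algorithms for lattice gauge theory;
figures of merit are autocorrelation/cost numbers at stated couplings and volumes; no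
continuum-physics claim.

Venture `LatticeQCDFlow` (cell pub-lqcd), topic `Exactness`; FANOUT row 13 (`eng-snf`, GEN-15).
NEW WORK of the cell (elementary asymptotic statistics of a monotone estimating equation: an exact
linearisation with a Lipschitz-derivative remainder, the strong law, Mathlib's CLT and Slutsky's
theorem), not a published result; nothing is cited as a fact (C. H. Bennett, J. Comput. Phys. 22
(1976) 245; M. R. Shirts, E. Bair, G. Hooker, V. S. Pande, Phys. Rev. Lett. 91 (2003) 140601; the
"sandwich" variance of Z- and M-estimators named only).  Fourth file of the GEN-15 group:
`…BennettRootConsistency` (every root sequence of the sample Bennett equation converges to the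
population root), `…BennettRootVariance` (noise `s²` and sensitivity `κ` at the root; for a Crooks
pair `s²/κ² = 1/G − 2`), `…BennettRootLinearization` (pointwise Taylor bound, the real-variable
inequality).

## Setting

Two probability laws `μF, μR` on records, measurable work `W`, paired independent sampling
`ω : ℕ → E × E` under `Measure.infinitePi (fun _ => μF ⊗ μR)`; one pair contributes
`ψ_d(p) = σ(d − W p.1) − σ(W p.2 − d)` to the sample Bennett gap `g_n(d, ω) = Σ_{i<n} ψ_d(ω i)`,
with `d`-derivative `φ_d(p) = σ'(d − W p.1) + σ'(W p.2 − d)`, `σ' = σ(1 − σ) ∈ (0, ¼]`.  `d⋆` is the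
population root (`E_{μF} σ(d⋆ − W) = E_{μR} σ(W − d⋆)`), `κ = E φ_{d⋆} > 0` the sensitivity,
`s² = Var_{μF ⊗ μR}[ψ_{d⋆}]` the noise, and `d̂_n` ANY measurable root of the sample equation
(`exists_measurable_barRoot`).

## Content

* **`tendstoInDistribution_sqrt_mul_barRoot_sub`** — THE CENTRAL LIMIT THEOREM OF THE ROOT:
  `√n (d̂_n − d⋆) →d N(0, s²/κ²)`.  Proof: `√n (d̂_n − d⋆) = [√n ḡ_n(d⋆)] · Z_n` exactly, where
  `ḡ_n(d⋆) = g_n(d⋆, ω)/n` obeys the CLT (mean zero at the root) and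
  `Z_n = (d̂_n − d⋆)/ḡ_n(d⋆) → −1/κ` almost surely (root property + pointwise Taylor bound + strong
  law for `φ_{d⋆}` + consistency of `d̂_n`), then Slutsky.
* **`CrooksPair.tendstoInDistribution_sqrt_mul_barRoot_sub`** — for every Crooks pair with
  `e^{−ΔF} = Z₁/Z₀`: `√n (ΔF̂_BAR,n − ΔF) →d N(0, 1/G − 2)`, `G = E_{P_F} σ(ΔF − W)` Bennett's
  overlap.  By `NCMCGeneralSpaceBennettOptimal.bennett_lower_bound` (GEN-11) and
  `…BennettRootVariance.inv_overlap_sub_two_eq_bennett_bound`, `1/G − 2 ≤ V₁(α)` for every fixed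
  positive square-integrable statistic `α` — THE SELF-CONSISTENT ROOT ATTAINS BENNETT'S LOWER BOUND,
  which the fixed-statistic estimators of GEN-12 (21) / GEN-14 (35), (37) reach only with the oracle
  weight `σ(W − ΔF)`.  For the engine (`snf.estimators.bar`): the honest large-`n` error bar of the
  reported BAR estimate over `n` independent pairs is `√((1/G − 2)/n)`.

Scope / NOT CLAIMED: paired independent evolutions (`nf = nr`); no rate / Berry–Esseen, no
finite-`n` coverage; a studentized version (plug-in `Ĝ`) is not in this file; correlated chain
starts are not covered; no value for any concrete protocol.
-/

namespace Summit.Ventures.LatticeQCDFlow.Exactness.GeneralNCMC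

open MeasureTheory ProbabilityTheory Set Filter Finset
open scoped ENNReal NNReal Topology

variable {E : Type*} [MeasurableSpace E]



/-! ## The central limit theorem of the root -/

section TwoLaws

variable (μF μR : Measure E) [IsProbabilityMeasure μF] [IsProbabilityMeasure μR]
variable {W : E → ℝ}
variable {Ω' : Type*} [MeasurableSpace Ω'] {P' : Measure Ω'} [IsProbabilityMeasure P']

/-- **Asymptotic normality of the root of the sample Bennett equation.**  Let `d⋆` be the
population root (`E_{μF} σ(d⋆ − W) = E_{μR} σ(W − d⋆)`) and `d̂_n` measurable roots of the sample
equation (`g_n(d̂_n, ω) = 0` for every `n ≥ 1` and every run).  Then along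
`Measure.infinitePi (fun _ => μF ⊗ μR)`
`√n (d̂_n − d⋆) →d N(0, s²/κ²)`, `s² = Var_{μF⊗μR}[σ(d⋆ − W_F) − σ(W_R − d⋆)]`,
`κ = E_{μF}[σ'(d⋆ − W)] + E_{μR}[σ'(W − d⋆)]` (`σ' = σ(1 − σ)`). -/
theorem tendstoInDistribution_sqrt_mul_barRoot_sub (hW : Measurable W) {dstar : ℝ}
    (hroot : ∫ a, Real.sigmoid (dstar - W a) ∂μF = ∫ a, Real.sigmoid (W a - dstar) ∂μR)
    {dhat : ℕ → (ℕ → E × E) → ℝ} (hdm : ∀ n, Measurable (dhat n))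
    (hdhat : ∀ n, 1 ≤ n → ∀ ω, (∑ i ∈ range n, Real.sigmoid (dhat n ω - W (ω i).1)) -
      ∑ i ∈ range n, Real.sigmoid (W (ω i).2 - dhat n ω) = 0)
    {Y : Ω' → ℝ}
    (hY : HasLaw Y (gaussianReal 0
      (Var[fun p : E × E => Real.sigmoid (dstar - W p.1) - Real.sigmoid (W p.2 - dstar); μF.prod μR] /
        ((∫ a, Real.sigmoid (dstar - W a) * (1 - Real.sigmoid (dstar - W a)) ∂μF) +
          ∫ a, Real.sigmoid (W a - dstar) * (1 - Real.sigmoid (W a - dstar)) ∂μR) ^ 2).toNNReal) P') :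
    TendstoInDistribution (fun (n : ℕ) (ω : ℕ → E × E) => √(n : ℝ) * (dhat n ω - dstar)) atTop Y
      (fun _ => Measure.infinitePi fun _ : ℕ => μF.prod μR) P' := by
  set μ := μF.prod μR with hμ
  -- the summand `ψ` at the root and its `d`-derivative `φ`
  set ψ : E × E → ℝ := fun p => Real.sigmoid (dstar - W p.1) - Real.sigmoid (W p.2 - dstar) with hψ
  set φ : E × E → ℝ := fun p => Real.sigmoid (dstar - W p.1) * (1 - Real.sigmoid (dstar - W p.1)) +
    Real.sigmoid (W p.2 - dstar) * (1 - Real.sigmoid (W p.2 - dstar)) with hφ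
  set κ := (∫ a, Real.sigmoid (dstar - W a) * (1 - Real.sigmoid (dstar - W a)) ∂μF) +
    ∫ a, Real.sigmoid (W a - dstar) * (1 - Real.sigmoid (W a - dstar)) ∂μR with hκ
  have hm1 : Measurable fun p : E × E => dstar - W p.1 := measurable_const.sub (hW.comp measurable_fst)
  have hm2 : Measurable fun p : E × E => W p.2 - dstar := (hW.comp measurable_snd).sub measurable_const
  have hσm : Measurable Real.sigmoid := _root_.continuous_sigmoid.measurable
  have hψm : Measurable ψ := (hσm.comp hm1).sub (hσm.comp hm2)
  have hφm : Measurable φ :=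
    ((hσm.comp hm1).mul (measurable_const.sub (hσm.comp hm1))).add
      ((hσm.comp hm2).mul (measurable_const.sub (hσm.comp hm2)))
  have hψ2 : MemLp ψ 2 μ := by
    refine MemLp.of_bound hψm.aestronglyMeasurable 2 (Eventually.of_forall fun p => ?_)
    rw [Real.norm_eq_abs]
    calc |ψ p| ≤ |Real.sigmoid (dstar - W p.1)| + |Real.sigmoid (W p.2 - dstar)| := abs_sub _ _
      _ ≤ 1 + 1 := add_le_add (by rw [abs_of_nonneg (Real.sigmoid_nonneg _)]; exact Real.sigmoid_le_one _)
          (by rw [abs_of_nonneg (Real.sigmoid_nonneg _)]; exact Real.sigmoid_le_one _)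
      _ = 2 := by norm_num
  have hφbound : ∀ p, |φ p| ≤ 1 / 2 := fun p => by
    have ha := dsigmoid_mem_Icc (dstar - W p.1)
    have hb := dsigmoid_mem_Icc (W p.2 - dstar)
    rw [abs_of_nonneg (add_nonneg ha.1 hb.1)]
    linarith [ha.2, hb.2]
  have hφi : Integrable φ μ :=
    (integrable_const (1 / 2 : ℝ)).mono' hφm.aestronglyMeasurable
      (Eventually.of_forall fun p => by rw [Real.norm_eq_abs]; exact hφbound p)
  -- means: `E ψ = 0` (root) and `E φ = κ`
  have hi1 : Integrable (fun p : E × E => Real.sigmoid (dstar - W p.1)) μ := integrable_sigmoid_comp hm1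
  have hi2 : Integrable (fun p : E × E => Real.sigmoid (W p.2 - dstar)) μ := integrable_sigmoid_comp hm2
  have hψmean : ∫ p, ψ p ∂μ = 0 := by
    rw [hψ]
    simp only
    rw [integral_sub hi1 hi2,
      integral_comp_of_measurePreserving (measurePreserving_fst (μ := μF) (ν := μR))
        (g := fun a => Real.sigmoid (dstar - W a))
        (hσm.comp (measurable_const.sub hW)).aestronglyMeasurable,
      integral_comp_of_measurePreserving (measurePreserving_snd (μ := μF) (ν := μR))
        (g := fun a => Real.sigmoid (W a - dstar))
        (hσm.comp (hW.sub measurable_const)).aestronglyMeasurable, hroot, sub_self]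
  have hj1 : Integrable (fun p : E × E => Real.sigmoid (dstar - W p.1) * (1 - Real.sigmoid (dstar - W p.1))) μ := by
    have := integrable_sigmoid_mul_sigmoid (μ := μ) (f := fun p : E × E => dstar - W p.1)
      (g := fun p : E × E => W p.1 - dstar) hm1 ((hW.comp measurable_fst).sub measurable_const)
    refine this.congr (Eventually.of_forall fun p => ?_)
    simp only
    rw [one_sub_sigmoid_sub (W p.1) dstar]
  have hj2 : Integrable (fun p : E × E => Real.sigmoid (W p.2 - dstar) * (1 - Real.sigmoid (W p.2 - dstar))) μ := by
    have := integrable_sigmoid_mul_sigmoid (μ := μ) (f := fun p : E × E => W p.2 - dstar)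
      (g := fun p : E × E => dstar - W p.2) hm2 (measurable_const.sub (hW.comp measurable_snd))
    refine this.congr (Eventually.of_forall fun p => ?_)
    simp only
    rw [one_sub_sigmoid_sub dstar (W p.2)]
  have hφmean : ∫ p, φ p ∂μ = κ := by
    rw [hφ, hκ]
    simp only
    rw [integral_add hj1 hj2,
      integral_comp_of_measurePreserving (measurePreserving_fst (μ := μF) (ν := μR))
        (g := fun a => Real.sigmoid (dstar - W a) * (1 - Real.sigmoid (dstar - W a)))
        ((hσm.comp (measurable_const.sub hW)).mul
          (measurable_const.sub (hσm.comp (measurable_const.sub hW)))).aestronglyMeasurable,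
      integral_comp_of_measurePreserving (measurePreserving_snd (μ := μF) (ν := μR))
        (g := fun a => Real.sigmoid (W a - dstar) * (1 - Real.sigmoid (W a - dstar)))
        ((hσm.comp (hW.sub measurable_const)).mul
          (measurable_const.sub (hσm.comp (hW.sub measurable_const)))).aestronglyMeasurable]
  -- `κ > 0`
  have hκpos : 0 < κ := by
    rw [← hφmean, integral_pos_iff_support_of_nonneg (fun p => ?_) hφi]
    · have hsupp : Function.support φ = univ := by
        ext p
        simp only [Function.mem_support, mem_univ, iff_true, hφ]
        have ha : 0 < Real.sigmoid (dstar - W p.1) * (1 - Real.sigmoid (dstar - W p.1)) :=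
          mul_pos (Real.sigmoid_pos _) (by linarith [Real.sigmoid_lt_one (dstar - W p.1)])
        have hb : 0 < Real.sigmoid (W p.2 - dstar) * (1 - Real.sigmoid (W p.2 - dstar)) :=
          mul_pos (Real.sigmoid_pos _) (by linarith [Real.sigmoid_lt_one (W p.2 - dstar)])
        exact (add_pos ha hb).ne'
      rw [hsupp, measure_univ]
      exact one_pos
    · exact add_nonneg (dsigmoid_mem_Icc _).1 (dsigmoid_mem_Icc _).1
  -- Step 1: the CLT for `ḡ_n(d⋆)`, against `−κ Y ~ N(0, s²)`
  have hY₀ := hasLaw_const_mul_gaussianReal (v := Var[ψ; μ]) (θ := κ) (c := -κ)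
    (variance_nonneg ψ μ) hκpos.ne' (neg_sq κ) hY
  have clt := tendstoInDistribution_sqrt_mul_sampleMean_sub μ hψm hψ2 hY₀
  -- Step 2: `Z_n = (d̂_n − d⋆)/ḡ_n(d⋆) → −κ⁻¹` almost surely
  set Z : ℕ → (ℕ → E × E) → ℝ := fun n ω =>
    if sampleMean ψ (fun i : Fin n => ω i) = 0 then -κ⁻¹
    else (dhat n ω - dstar) / sampleMean ψ (fun i : Fin n => ω i) with hZ
  have hZmeas : ∀ n, Measurable (Z n) := fun n =>
    Measurable.ite (measurableSet_eq_fun (measurable_sampleMean_run hψm n) measurable_const)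
      measurable_const (((hdm n).sub_const dstar).div (measurable_sampleMean_run hψm n))
  -- the root property in `sampleMean` form and the linearisation inequality
  have hroot' : ∀ n, 1 ≤ n → ∀ ω : ℕ → E × E,
      sampleMean (fun p : E × E => Real.sigmoid (dhat n ω - W p.1) - Real.sigmoid (W p.2 - dhat n ω))
        (fun i : Fin n => ω i) = 0 := fun n hn ω => by
    unfold sampleMean
    rw [Fin.sum_univ_eq_sum_range
      (fun i => Real.sigmoid (dhat n ω - W (ω i).1) - Real.sigmoid (W (ω i).2 - dhat n ω)) n,
      sum_sub_distrib, hdhat n hn ω, zero_div]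
  have hlin : ∀ n, 1 ≤ n → ∀ ω : ℕ → E × E,
      |sampleMean ψ (fun i : Fin n => ω i) +
        sampleMean φ (fun i : Fin n => ω i) * (dhat n ω - dstar)| ≤ (dhat n ω - dstar) ^ 2 / 2 := by
    intro n hn ω
    have hsm : sampleMean (fun p : E × E =>
        (Real.sigmoid (dhat n ω - W p.1) - Real.sigmoid (W p.2 - dhat n ω)) - ψ p -
          φ p * (dhat n ω - dstar)) (fun i : Fin n => ω i) =
        sampleMean (fun p : E × E => Real.sigmoid (dhat n ω - W p.1) - Real.sigmoid (W p.2 - dhat n ω))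
          (fun i : Fin n => ω i) - sampleMean ψ (fun i : Fin n => ω i) -
          sampleMean φ (fun i : Fin n => ω i) * (dhat n ω - dstar) := by
      unfold sampleMean
      rw [sum_sub_distrib, sum_sub_distrib, ← sum_mul]
      have hn' : (n : ℝ) ≠ 0 := by exact_mod_cast (show n ≠ 0 by omega)
      field_simp
    have hb := abs_sampleMean_le (F := fun p : E × E =>
        (Real.sigmoid (dhat n ω - W p.1) - Real.sigmoid (W p.2 - dhat n ω)) - ψ p -
          φ p * (dhat n ω - dstar)) (y := fun i : Fin n => ω i) (B := 1 / 2 * (dhat n ω - dstar) ^ 2)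
      (by positivity) (fun i => abs_barSummand_taylor_le (W (ω i).1) (W (ω i).2) dstar (dhat n ω))
    rw [hsm, hroot' n hn ω, zero_sub] at hb
    rw [show sampleMean ψ (fun i : Fin n => ω i) + sampleMean φ (fun i : Fin n => ω i) * (dhat n ω - dstar) =
      -(-sampleMean ψ (fun i : Fin n => ω i) - sampleMean φ (fun i : Fin n => ω i) * (dhat n ω - dstar)) by ring,
      abs_neg]
    linarith
  have hZae : ∀ᵐ ω ∂(Measure.infinitePi fun _ : ℕ => μ), Tendsto (fun n => Z n ω) atTop (𝓝 (-κ⁻¹)) := by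
    filter_upwards [tendsto_barRoot_ae μF μR hW hroot, tendsto_sampleMean_ae μ hφm hφi] with ω hωroot hωφ
    have hcons : Tendsto (fun n => dhat n ω) atTop (𝓝 dstar) :=
      hωroot (fun n => dhat n ω) (eventually_atTop.2 ⟨1, fun n hn => hdhat n hn ω⟩)
    rw [hφmean] at hωφ
    -- `η_n = |A_n − κ| + |Δ_n|/2 → 0`
    have hη : Tendsto (fun n => |sampleMean φ (fun i : Fin n => ω i) - κ| + |dhat n ω - dstar| / 2)
        atTop (𝓝 0) := by
      have h1 : Tendsto (fun n => |sampleMean φ (fun i : Fin n => ω i) - κ|) atTop (𝓝 0) := by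
        have := (hωφ.sub_const κ).abs
        rwa [sub_self, abs_zero] at this
      have h2 : Tendsto (fun n => |dhat n ω - dstar| / 2) atTop (𝓝 0) := by
        have := ((hcons.sub_const dstar).abs).div_const 2
        rwa [sub_self, abs_zero, zero_div] at this
      simpa using h1.add h2
    rw [Metric.tendsto_atTop]
    intro ε hε
    have hε1 : (0 : ℝ) < κ / 2 := by positivity
    have hε2 : (0 : ℝ) < ε * κ ^ 2 / 2 := by positivity
    obtain ⟨N, hN⟩ := (((hη.eventually (gt_mem_nhds hε1)).and (hη.eventually (gt_mem_nhds hε2))).and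
      (eventually_ge_atTop 1)).exists_forall_of_atTop
    refine ⟨N, fun n hn => ?_⟩
    obtain ⟨⟨hn1, hn2⟩, hn3⟩ := hN n hn
    rw [Real.dist_eq]
    by_cases hg : sampleMean ψ (fun i : Fin n => ω i) = 0
    · simp only [hZ, hg, ↓reduceIte, sub_self, abs_zero]
      exact hε
    · simp only [hZ, hg, ↓reduceIte, sub_neg_eq_add]
      exact abs_div_add_inv_lt hκpos hε hg (hlin n hn3 ω) hn1 hn2
  have hZP : TendstoInMeasure (Measure.infinitePi fun _ : ℕ => μ) Z atTop (fun _ => -κ⁻¹) :=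
    tendstoInMeasure_of_tendsto_ae (fun n => (hZmeas n).aestronglyMeasurable) hZae
  -- Step 3: Slutsky, and the exact identity `√n (d̂_n − d⋆) = [√n ḡ_n(d⋆)] · Z_n`
  have slutsky := clt.continuous_comp_prodMk_of_tendstoInMeasure_const
    (g := fun p : ℝ × ℝ => p.1 * p.2) (by fun_prop) hZP (fun n => (hZmeas n).aemeasurable)
  have hlim : (fun ω' => -κ * Y ω' * -κ⁻¹) = Y := by
    funext ω'
    field_simp
  simp only at slutsky
  rw [hlim] at slutsky
  refine slutsky.congr (fun n => Eventually.of_forall fun ω => ?_) EventuallyEq.rfl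
  rw [hψmean, sub_zero]
  symm
  by_cases hg : sampleMean ψ (fun i : Fin n => ω i) = 0
  · -- then `d̂_n = d⋆` (strict monotonicity of the sample gap; `n = 0` is trivial)
    simp only [hZ, hg, ↓reduceIte, zero_mul, mul_zero]
    rcases Nat.eq_zero_or_pos n with rfl | hn
    · simp
    · have hgap0 : (∑ i ∈ range n, Real.sigmoid (dstar - W (ω i).1)) -
          ∑ i ∈ range n, Real.sigmoid (W (ω i).2 - dstar) = 0 := by
        have hg' := hg
        unfold sampleMean at hg'
        rw [Fin.sum_univ_eq_sum_range (fun i => ψ (ω i)) n, div_eq_zero_iff] at hg'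
        rcases hg' with hg' | hg'
        · rw [hψ] at hg'
          simp only at hg'
          rwa [sum_sub_distrib] at hg'
        · exact absurd hg' (by exact_mod_cast hn.ne')
      have heq : dhat n ω = dstar :=
        (sampleBarGap_strictMono W ω hn).injective ((hdhat n hn ω).trans hgap0.symm)
      rw [heq, sub_self, mul_zero]
  · simp only [hZ, hg, ↓reduceIte]
    rw [mul_assoc, mul_div_cancel₀ _ hg]

end TwoLaws

/-! ## Crooks pairs: the BAR estimate is asymptotically normal with variance `(1/G − 2)/n` -/

namespace CrooksPair

variable {Ω : Type*} [MeasurableSpace Ω]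
variable {ν₀ ν₁ : Measure Ω} {κF κR : Kernel Ω E} {s e : E → Ω} {W : E → ℝ}
variable {Ω' : Type*} [MeasurableSpace Ω'] {P' : Measure Ω'} [IsProbabilityMeasure P']

/-- **Asymptotic normality of the self-consistent Bennett estimate; it attains Bennett's bound.**
For every Crooks pair with `e^{−ΔF} = Z₁/Z₀` and every measurable root selection `ΔF̂_n` of the
sample Bennett equation (`exists_measurable_barRoot`), along independent paired evolutions
`√n (ΔF̂_n − ΔF) →d N(0, 1/G − 2)`, `G = E_{P_F} σ(ΔF − W)` the overlap — the value
`1/G − 1/nf − 1/nr` (`nf = nr = 1`) below which no fixed positive statistic can push the two-sample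
variance (`bennett_lower_bound`). -/
theorem tendstoInDistribution_sqrt_mul_barRoot_sub [IsFiniteMeasure ν₀] [IsFiniteMeasure ν₁]
    [IsMarkovKernel κF] [IsMarkovKernel κR] (h0 : ν₀ univ ≠ 0) (h1 : ν₁ univ ≠ 0)
    (h : CrooksPair ν₀ ν₁ κF κR s e W) {ΔF : ℝ}
    (hΔF : Real.exp (-ΔF) = ((ν₀ univ)⁻¹ * ν₁ univ).toReal)
    {dhat : ℕ → (ℕ → E × E) → ℝ} (hdm : ∀ n, Measurable (dhat n))
    (hdhat : ∀ n, 1 ≤ n → ∀ ω, (∑ i ∈ range n, Real.sigmoid (dhat n ω - W (ω i).1)) -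
      ∑ i ∈ range n, Real.sigmoid (W (ω i).2 - dhat n ω) = 0)
    {Y : Ω' → ℝ}
    (hY : HasLaw Y (gaussianReal 0
      (1 / (∫ ε, Real.sigmoid (ΔF - W ε) ∂(fwdPathLaw ν₀ κF)) - 2).toNNReal) P') :
    haveI := isProbabilityMeasure_fwdPathLaw ν₀ h0 κF
    haveI := isProbabilityMeasure_fwdPathLaw ν₁ h1 κR
    TendstoInDistribution (fun (n : ℕ) (ω : ℕ → E × E) => √(n : ℝ) * (dhat n ω - ΔF)) atTop Y
      (fun _ => Measure.infinitePi fun _ : ℕ => (fwdPathLaw ν₀ κF).prod (fwdPathLaw ν₁ κR)) P' := by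
  haveI := isProbabilityMeasure_fwdPathLaw ν₀ h0 κF
  haveI := isProbabilityMeasure_fwdPathLaw ν₁ h1 κR
  have hvar : Var[fun p : E × E => Real.sigmoid (ΔF - W p.1) - Real.sigmoid (W p.2 - ΔF);
      (fwdPathLaw ν₀ κF).prod (fwdPathLaw ν₁ κR)] =
      Var[fun ε => Real.sigmoid (ΔF - W ε); fwdPathLaw ν₀ κF] +
        Var[fun ε => Real.sigmoid (W ε - ΔF); fwdPathLaw ν₁ κR] := by
    have := variance_fst_sub_mul_snd (fwdPathLaw ν₀ κF) (fwdPathLaw ν₁ κR)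
      (f := fun ε => Real.sigmoid (ΔF - W ε)) (g := fun ε => Real.sigmoid (W ε - ΔF))
      (_root_.continuous_sigmoid.measurable.comp (measurable_const.sub h.measurable_W))
      (_root_.continuous_sigmoid.measurable.comp (h.measurable_W.sub measurable_const))
      (memLp_two_sigmoid_comp (measurable_const.sub h.measurable_W))
      (memLp_two_sigmoid_comp (h.measurable_W.sub measurable_const)) 1
    simpa only [one_mul, one_pow] using this
  rw [← h.barNoise_div_sensitivity_sq_eq h0 h1 hΔF, ← hvar] at hY
  exact GeneralNCMC.tendstoInDistribution_sqrt_mul_barRoot_sub (fwdPathLaw ν₀ κF)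
    (fwdPathLaw ν₁ κR) h.measurable_W ((h.integral_sigmoid_fwd_eq_rev_iff h0 h1 hΔF ΔF).2 rfl) hdm hdhat hY

end CrooksPair

end Summit.Ventures.LatticeQCDFlow.Exactness.GeneralNCMC
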